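import Literature.MathematicalPhysics.QuantumFieldTheory.Balaban1983to89.B9CubeBondWeights
import Literature.MathematicalPhysics.QuantumFieldTheory.Balaban1983to89.B6Cor28EntriesKLevelV1L0
import Literature.MathematicalPhysics.QuantumFieldTheory.Balaban1983to89.B6Prop26LapKLevelV1L0

/-!
# `Balaban1983to89.B9Thm33CubeAtOne` — [B9] THEOREM 3.3 AT `U = 1` FOR THE CUBE-LOCAL VECTOR PROPAGATOR `G_□(1)` AND ITS `H_□ = G_□Q*(QG_□Q*)⁻¹`:
# [4] PROP. 2.6 (2.136)₁,₂,₃ AND COR. 2.8 (2.151)₁,₂ AT k LEVELS FOR THE CUBE SEQUENCE `{Ω_n(□)}`, BY NAME from the `…V1L0` lineage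
# (`B6Prop26LapKLevelV1L0.prop26_2136_lap_kLevel_unconditional`, `B6Cor28EntriesKLevelV1L0.cor28_kLevel_H ∕ _H_DH`) at the data of
# `B9CubeBondWeights` (`domCube`, `wCubeBond`, `placed_cubeFamY`) — sub-row G-B9-LETTERS, module M5.1c part 2 (P3), lead g29 RULING #5

FRAMING (verbatim cell line):
statement-level skeleton of published theorems with citation tags; proofs where landed; nothing here is a claim about the Yang–Mills mass gap

Sources under audit (cell lit-balaban): T. Bałaban, *Propagators for lattice gauge theories in a background field*, Commun. Math. Phys. **99**
(1985) 389–434 [`Balaban1985BackgroundPropagators`, "B9"], Thm 3.3 p. 399, Cor. 3.5 p. 407, p. 409 l. 1–5; T. Bałaban, *Propagators and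
renormalization transformations for lattice gauge theories. II*, Commun. Math. Phys. **96** (1984) 223–250 [`Balaban1984PropagatorsII`, "[4]"],
Prop. 2.6 (2.136) p. 247, Cor. 2.8 (2.150)–(2.151) p. 249.  Unit `lit-balaban-r05` (r05 gen 77).

## WHAT IS PRINTED (verbatim up to notation)

[B9] p. 409 l. 1–5: «The operators constructed for this sequence, which we denote by G′_□(U), C_□(U) …, G_□(U), satisfy all the inequalities of
Theorems 3.1–3.3»; Cor. 3.5 p. 407: at `U = 1` the operators are those of [4]; [4] Prop. 2.6 (2.136) p. 247: «|G(b,b′)|, |(∇G)(b,b′)|, |(ΔG)(b,b′)| ≦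
O(1)[1, (L^jη)^{−1}, (L^jη)^{−2}]… e^{−δ₃d(y,y′)}»; Cor. 2.8 (2.151) p. 249: «|H(b,c)|, |(∇H)(b,c)| ≦ O(1)[1, (L^jη)^{−1}](L^{j′}η)^{−d}e^{−δ₅d(y,c₋)}».

## WHAT THIS FILE CERTIFIES (kernel-checked; def-Y index `i : KIdx d ℓ hd hL b₀ b₁` with `0 < b₀ ≤ b₁`, cover cube `q`, `F := cubeFamY i q`,
## `G_□(1) := GE (domCube i q) i.hcf (wCubeBond_pos i q hb₀)` = the genuine `Δ_a⁻¹` of [4] for the cube sequence with the weights `w_□`)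

* ★ `thm33_cube_atOne_G` — (2.136)₁,₂,₃ for `G_□(1)`: `HasMajorant` over the cube sequence's torus geometry `geomT F` (blocks `blkV1 i.hN F`)
  of `G_□(1)`, `∇_νG_□(1)`, `ΔG_□(1)` with kernels `A·[pref, len·|c′|⁻¹, 1]·e^{−δ₃(α,2σ)d}` — ONE set of constants for all members and cubes
  (threshold `M₂ ≤ L·M_h`);
* ★ `thm33_cube_atOne_H` — (2.151)₁ for `H_□ = G_□Q*(QG_□Q*)⁻¹ = GE ∘ QsE ∘ EE` (entries and `HasMajorantHom`), `thm33_cube_atOne_DH` — (2.151)₁,₂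
  (entries of `H_□` and `∇_νH_□`) — thresholds `M₂ ≤ L·M_h`, `N₁ + 1 ≤ R·L·M_h`.
All binders other than the thresholds are def-Y's `KIdx` fields and `B9CubeBondWeights`' three inputs; proofs are one-line instantiations.

## HONEST SCOPE

* `U = 1` only; the cube sequence's bond weights are `wCubeBond` (the member's on the member's index bonds, band edge elsewhere — a choice within
  print's band); nothing continuum; the general-`U` letters `G_□(U)`, `C_□(U)` ((P4)) are NOT here.
* Nothing is inferred from the manuscript; kernel-checked.  NOT summit progress; the YM mass gap is not proved by any of this.
-/

namespace Literature.MathematicalPhysics.QuantumFieldTheory.Balaban1983to89.B9Thm33CubeAtOne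

open LatticeFieldCalculus
open Node00
open scoped InnerProductSpace
open Literature.MathematicalPhysics.QuantumFieldTheory.Balaban1983to89.B6KLevelCensusIndexV1 (KIdx)
open Literature.MathematicalPhysics.QuantumFieldTheory.Balaban1983to89.B6SectAOperatorsV1 (QsE BondIdx)
open Literature.MathematicalPhysics.QuantumFieldTheory.Balaban1983to89.B6SectAVectorModelV1 (GE EE)
open Literature.MathematicalPhysics.QuantumFieldTheory.Balaban1983to89.B6Ineq2133TwoScaleV1 (onFun)
open Literature.MathematicalPhysics.QuantumFieldTheory.Balaban1983to89.B6GlobalChartV1 (PV)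
open Literature.MathematicalPhysics.QuantumFieldTheory.Balaban1983to89.B6GlobalChartV1L0 (blkV1)
open Literature.MathematicalPhysics.QuantumFieldTheory.Balaban1983to89.B6Geom246MultiLevelTorusL0 (geomT)
open Literature.MathematicalPhysics.QuantumFieldTheory.Balaban1983to89.B6Ineq2142KLevelV1L0 (β)
open Literature.MathematicalPhysics.QuantumFieldTheory.Balaban1983to89.B6RandomWalk (HasMajorant delta3)
open Literature.MathematicalPhysics.QuantumFieldTheory.Balaban1983to89.B6RandomWalkHom (HasMajorantHom)
open Literature.MathematicalPhysics.QuantumFieldTheory.Balaban1983to89.B6Prop26KLevelSkeletonV1L0 (pref)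
open Literature.MathematicalPhysics.QuantumFieldTheory.Balaban1983to89.B6GradLegKLevelV1 (DV)
open Literature.MathematicalPhysics.QuantumFieldTheory.Balaban1983to89.B6LapLegKLevelV1 (LapV)
open Literature.MathematicalPhysics.QuantumFieldTheory.Balaban1983to89.B6Cover236MultiLevelBlocks (cubes)
open Literature.MathematicalPhysics.QuantumFieldTheory.Balaban1983to89.B6Prop26LapKLevelV1L0 (prop26_2136_lap_kLevel_unconditional)
open Literature.MathematicalPhysics.QuantumFieldTheory.Balaban1983to89.B6Cor28EntriesKLevelV1L0 (cor28_kLevel_H cor28_kLevel_H_DH)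
open Literature.MathematicalPhysics.QuantumFieldTheory.Balaban1983to89.B9CubeLettersOpsL0 (cubeFamY)
open Literature.MathematicalPhysics.QuantumFieldTheory.Balaban1983to89.B9CubeBondWeights (domCube wCubeBond wCubeBond_pos wCubeBond_band placed_cubeFamY)

variable {d ℓ : ℕ} {hd : 1 ≤ d + 1} {hL : Odd (ℓ + 1) ∧ 1 < ℓ + 1} {b₀ b₁ : ℝ}

/-- ★ **[4] PROP. 2.6 (2.136)₁,₂,₃ AT k LEVELS FOR THE CUBE-LOCAL `G_□(1)`** (= [B9] Thm 3.3 at `U = 1` for `G_□`, the entries of `G_□`, `∇G_□`,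
`ΔG_□`), one set of constants for all members and cubes.
[cite: Balaban1985BackgroundPropagators, Thm 3.3 p.399, Cor. 3.5 p.407, p.409 l.1–5; Balaban1984PropagatorsII, Prop. 2.6 (2.136) p.247] -/
theorem thm33_cube_atOne_G (hb₀ : 0 < b₀) (hb₁ : b₀ ≤ b₁) :
    ∃ σ₁ : ℝ, 0 < σ₁ ∧ ∀ (σ : ℝ), 0 < σ → σ ≤ σ₁ → ∀ (α : ℝ), 0 < α → α ≤ 1 →
    ∃ A M₂ : ℝ, 0 ≤ A ∧ 0 < M₂ ∧
    ∀ (i : KIdx d ℓ hd hL b₀ b₁) (q : ↥(cubes (toKT i).D.toDomains)), M₂ ≤ ((ℓ : ℝ) + 1) * i.Mh →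
      HasMajorant (g := geomT (cubeFamY i q)) (blkV1 i.hN (cubeFamY i q)) (onFun (GE (domCube i q) i.hcf (wCubeBond_pos i q hb₀)))
        (fun y y' => A * pref i.cf y * Real.exp (-(delta3 α (2 * σ) * (geomT (cubeFamY i q)).dist y y'))) ∧
      (∀ ν : Fin (d + 1), HasMajorant (g := geomT (cubeFamY i q)) (blkV1 i.hN (cubeFamY i q))
        (DV ν i.cf ∘ₗ onFun (GE (domCube i q) i.hcf (wCubeBond_pos i q hb₀)))
        (fun y y' => A * ((geomT (cubeFamY i q)).len y * |i.cf|⁻¹) * Real.exp (-(delta3 α (2 * σ) * (geomT (cubeFamY i q)).dist y y')))) ∧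
      HasMajorant (g := geomT (cubeFamY i q)) (blkV1 i.hN (cubeFamY i q))
        (LapV i.cf ∘ₗ onFun (GE (domCube i q) i.hcf (wCubeBond_pos i q hb₀)))
        (fun y y' => A * Real.exp (-(delta3 α (2 * σ) * (geomT (cubeFamY i q)).dist y y'))) := by
  obtain ⟨σ₁, hσ₁, h⟩ := prop26_2136_lap_kLevel_unconditional d ℓ hd hL hb₀ hb₁
  refine ⟨σ₁, hσ₁, fun σ hσ hσ1 α hα hα1 => ?_⟩
  obtain ⟨A, M₂, hA, hM₂, h2⟩ := h σ hσ hσ1 α hα hα1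
  refine ⟨A, M₂, hA, hM₂, fun i q hM => ?_⟩
  exact h2 i.m i.K i.hN (cubeFamY i q) i.hk i.hk2 i.hMha i.hM8 i.hR2 i.hP5 i.hℓ (placed_cubeFamY i q) hM i.hcf
    (wCubeBond_pos i q hb₀) (wCubeBond_band i q hb₁)

/-- ★ **[4] COR. 2.8 (2.151)₁ AT k LEVELS FOR THE CUBE-LOCAL `H_□ = G_□Q*(QG_□Q*)⁻¹`** (= [B9] Thm 3.3 at `U = 1`, the `H`-part), entries and the
`Hom`-majorant, one set of constants for all members and cubes.
[cite: Balaban1985BackgroundPropagators, Thm 3.3 p.399, Cor. 3.5 p.407, p.409 l.1–5; Balaban1984PropagatorsII, Cor. 2.8 (2.150)–(2.151) p.249] -/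
theorem thm33_cube_atOne_H (hb₀ : 0 < b₀) (hb₁ : b₀ ≤ b₁) :
    ∃ σ₁ : ℝ, 0 < σ₁ ∧ ∀ (σ : ℝ), 0 < σ → σ ≤ σ₁ → ∀ (α : ℝ), 0 < α → α < 1 →
    ∃ (δ₅ C M₂ : ℝ) (N₁ : ℕ), 0 < δ₅ ∧ 0 ≤ C ∧ 0 < M₂ ∧
    ∀ (i : KIdx d ℓ hd hL b₀ b₁) (q : ↥(cubes (toKT i).D.toDomains)),
      M₂ ≤ ((ℓ : ℝ) + 1) * i.Mh → N₁ + 1 ≤ i.R * ((ℓ + 1) * i.Mh) →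
      (∀ (c : BondIdx (domCube i q)) (f : PBond (PV d ℓ i.m i.K hd hL) 0),
        |(GE (domCube i q) i.hcf (wCubeBond_pos i q hb₀) ∘ₗ QsE (domCube i q) ∘ₗ EE (domCube i q) i.hcf (wCubeBond_pos i q hb₀))
            (EuclideanSpace.single c (1 : ℝ)) f| ≤
          C * Real.exp (-(δ₅ * (geomT (cubeFamY i q)).dist (blkV1 i.hN (cubeFamY i q) f) (β i.hN (cubeFamY i q) i.hk c)))) ∧
      HasMajorantHom (g := geomT (cubeFamY i q)) (β i.hN (cubeFamY i q) i.hk) (blkV1 i.hN (cubeFamY i q))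
        (onFun (GE (domCube i q) i.hcf (wCubeBond_pos i q hb₀) ∘ₗ QsE (domCube i q) ∘ₗ EE (domCube i q) i.hcf (wCubeBond_pos i q hb₀)))
        (fun y y' => 2 * ((d : ℝ) + 1) * C * Real.exp (-(δ₅ * (geomT (cubeFamY i q)).dist y y'))) := by
  obtain ⟨σ₁, hσ₁, h⟩ := cor28_kLevel_H d ℓ hd hL hb₀ hb₁
  refine ⟨σ₁, hσ₁, fun σ hσ hσ1 α hα hα1 => ?_⟩
  obtain ⟨δ₅, C, M₂, N₁, hδ₅, hC, hM₂, h2⟩ := h σ hσ hσ1 α hα hα1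
  refine ⟨δ₅, C, M₂, N₁, hδ₅, hC, hM₂, fun i q hM hRM => ?_⟩
  exact h2 i.m i.K i.hN (cubeFamY i q) i.hk i.hk2 i.hMha i.hM8 i.hR2 i.hP5 i.hℓ (placed_cubeFamY i q) hM hRM i.hcf
    (wCubeBond_pos i q hb₀) (wCubeBond_band i q hb₁)

/-- ★ **[4] COR. 2.8 (2.151)₁,₂ AT k LEVELS FOR THE CUBE-LOCAL `H_□`**: the entries of `H_□` and of `∇_νH_□`.
[cite: Balaban1985BackgroundPropagators, Thm 3.3 p.399, Cor. 3.5 p.407, p.409 l.1–5; Balaban1984PropagatorsII, Cor. 2.8 (2.150)–(2.151) p.249] -/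
theorem thm33_cube_atOne_DH (hb₀ : 0 < b₀) (hb₁ : b₀ ≤ b₁) :
    ∃ σ₁ : ℝ, 0 < σ₁ ∧ ∀ (σ : ℝ), 0 < σ → σ ≤ σ₁ → ∀ (α : ℝ), 0 < α → α < 1 →
    ∃ (δ₅ C M₂ : ℝ) (N₁ : ℕ), 0 < δ₅ ∧ 0 ≤ C ∧ 0 < M₂ ∧
    ∀ (i : KIdx d ℓ hd hL b₀ b₁) (q : ↥(cubes (toKT i).D.toDomains)),
      M₂ ≤ ((ℓ : ℝ) + 1) * i.Mh → N₁ + 1 ≤ i.R * ((ℓ + 1) * i.Mh) →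
      (∀ (c : BondIdx (domCube i q)) (f : PBond (PV d ℓ i.m i.K hd hL) 0),
        |(GE (domCube i q) i.hcf (wCubeBond_pos i q hb₀) ∘ₗ QsE (domCube i q) ∘ₗ EE (domCube i q) i.hcf (wCubeBond_pos i q hb₀))
            (EuclideanSpace.single c (1 : ℝ)) f| ≤
          C * Real.exp (-(δ₅ * (geomT (cubeFamY i q)).dist (blkV1 i.hN (cubeFamY i q) f) (β i.hN (cubeFamY i q) i.hk c)))) ∧
      (∀ (ν : Fin (d + 1)) (c : BondIdx (domCube i q)) (f : PBond (PV d ℓ i.m i.K hd hL) 0),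
        |(DV ν i.cf ∘ₗ onFun (GE (domCube i q) i.hcf (wCubeBond_pos i q hb₀) ∘ₗ QsE (domCube i q) ∘ₗ
            EE (domCube i q) i.hcf (wCubeBond_pos i q hb₀))) (Pi.single c 1) f| ≤
          C * ((geomT (cubeFamY i q)).len (blkV1 i.hN (cubeFamY i q) f) * |i.cf|⁻¹)⁻¹ *
            Real.exp (-(δ₅ * (geomT (cubeFamY i q)).dist (blkV1 i.hN (cubeFamY i q) f) (β i.hN (cubeFamY i q) i.hk c)))) := by
  obtain ⟨σ₁, hσ₁, h⟩ := cor28_kLevel_H_DH d ℓ hd hL hb₀ hb₁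
  refine ⟨σ₁, hσ₁, fun σ hσ hσ1 α hα hα1 => ?_⟩
  obtain ⟨δ₅, C, M₂, N₁, hδ₅, hC, hM₂, h2⟩ := h σ hσ hσ1 α hα hα1
  refine ⟨δ₅, C, M₂, N₁, hδ₅, hC, hM₂, fun i q hM hRM => ?_⟩
  exact h2 i.m i.K i.hN (cubeFamY i q) i.hk i.hk2 i.hMha i.hM8 i.hR2 i.hP5 i.hℓ (placed_cubeFamY i q) hM hRM i.hcf
    (wCubeBond_pos i q hb₀) (wCubeBond_band i q hb₁)

end Literature.MathematicalPhysics.QuantumFieldTheory.Balaban1983to89.B9Thm33CubeAtOne
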